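import Literature.IUT.HodgeArakelov.ThetaEvaluationModelEv

/-!
# The CANONICAL level retractions `Π_Ÿ(Π) ∩ K′ → D ∩ K` from the augmentation `q : Π ↠ G_k` (injective on the
# decomposition group `D = D_{μ_-}`), and the resulting inflation section ([IUTchII] Cor. 1.12 (c)/(ii))

abc-iut cell, D-0067 wave 4 (seat abc-iut-w4-d043 gen 2; L6-lead ruling §F v1.18c (1) «GO d043 model-Ev
(inflation section)»; SUBDAG `plan/L6/SUBDAG-IUTchII-Cor-112.md` rows Cor-112.0.r1 / Cor-112.ii.r13). Second part of
`ThetaEvaluationModelEv.lean` (the generic inflation section `LevelRetraction.h1LimSection` of abc-iut-L6-t1's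
`h1LimRestrict` from level-retraction DATA): here the data are CONSTRUCTED from an augmentation.

S. Mochizuki, *Inter-universal Teichmüller theory II*, kurims manuscript (Dec. 2020), Cor. 1.12 p. 56 (c) ("a natural
inclusion `M^×_TM(Π) ↪ lim_J H¹(J, (l·Δ_Θ)(Π))`, hence a natural inclusion of `M^×_TM(Π)` into the inductive limit of
the first line") and (ii) p. 57 ("restriction to the subgroup `D ⊆ Π_Ÿ(Π)`"); Rmk. 1.4.1 (ii) p. 28 ("`D_{μ_-} ⊆ Π_{Ÿ}`
for the decomposition group of `(μ_-)_Ÿ`"). Claim key `Mochizuki2012` (D-0012, DISPUTED); the construction is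
elementary topological group theory [cite: NeukirchSchmidtWingberg2008, I §5]; nothing here takes a side on
[IUTchIII] Cor. 3.12.

CONSTRUCTED, for a homomorphism `q : Π → Q` (the augmentation `Π ↠ G_k`) and subgroups `D ≤ H ≤ Π`:
* `liftSubgroup q D K := K ∩ q⁻¹(q(D ∩ K))` — the lifted level (monotone, `D ∩ K ⊆ liftSubgroup K ⊆ K`);
* `retractFun` / **`retract hDq H K : H ∩ liftSubgroup K →* D ∩ K`**, `k ↦` the UNIQUE `d ∈ D ∩ K` with `q(d) = q(k)`
  — unique because `D ∩ Ker(q) = 1` (`hDq`; `D_{μ_-}` is the decomposition group of a closed point, so `D ∩ Δ = 1`);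
  `q_retract`, `retractFun_eq` (uniqueness), `retractFun_of_mem` (identity on `D`), `retract_compat` (along levels);
* `retract_act` — `k` and `retract k` act identically on the coefficients, given that `Ker(q)` acts trivially (`hN`;
  at the model `Δ` acts trivially on `(l·Δ_Θ)(Π)`: `Δ_Θ` is central in `Δ^Θ` [cite: MochizukiEtTh2009, §1 p.12]);
* `continuous_retract` — continuity, from `q` continuous and `q|_{D ∩ K}` a topological embedding (`hemb`; at the
  model `D` is profinite/compact and `G_k` Hausdorff): `retract = (q|_{D ∩ K})⁻¹ ∘ q`;
* `liftIdx` (the lifted level as an index; finite index + openness = `hlift`, at the model because `q(D ∩ K)` is an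
  open subgroup of finite index of `G_k`), **`LevelRetraction.ofAugmentation`**, and the specialised section identity
  `h1LimRestrict_h1LimSection_ofAugmentation`.
The four side conditions `hDq`, `hN`, `hlift`, `hemb` are `Prop`-BINDERS of printed/classical shape (dischargeable
proof-only at the model); no `Prop`-valued definition is introduced. Typed ≠ discharged.
-/

namespace Literature.IUT.HodgeArakelov

open Literature.AnabelianGeometry.EtaleTheta CohomologySystemOfContH1

universe u

noncomputable section

variable {P : TopGroup.{u}} {G' : Type u} [Group G'] [TopologicalSpace G'] [IsTopologicalGroup G']
  (φ : P →* G') (A : Subgroup G') [A.Normal] [IsMulCommutative A]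

namespace CohomologySystemOfContH1

/-! ### The canonical level retractions from an augmentation `q : Π → G_k` that is injective on `D` -/

section OfAugmentation

variable {Q : Type u} [Group Q] (q : P →* Q) (D : Subgroup P)

/-- The lifted level `K ∩ q⁻¹(q(D ∩ K))` of a level `K` (DEFINED): the elements of `K` whose image in `G_k` is the
image of an element of `D ∩ K`. [cite: Mochizuki2012, Cor 1.12 (c) p.56] -/
def liftSubgroup (K : Subgroup P) : Subgroup P := K ⊓ ((D ⊓ K).map q).comap q

/-- `liftSubgroup K ≤ K`. [cite: Mochizuki2012, Cor 1.12 (c) p.56] -/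
theorem liftSubgroup_le (K : Subgroup P) : liftSubgroup q D K ≤ K := inf_le_left

/-- `liftSubgroup` is monotone in the level. [cite: Mochizuki2012, Cor 1.12 (c) p.56] -/
theorem liftSubgroup_mono {K₁ K₂ : Subgroup P} (h : K₁ ≤ K₂) : liftSubgroup q D K₁ ≤ liftSubgroup q D K₂ :=
  inf_le_inf h (Subgroup.comap_mono (Subgroup.map_mono (inf_le_inf_left D h)))

/-- `D ∩ K ⊆ liftSubgroup K`. [cite: Mochizuki2012, Cor 1.12 (c) p.56] -/
theorem inf_le_liftSubgroup (K : Subgroup P) : D ⊓ K ≤ liftSubgroup q D K :=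
  le_inf inf_le_right fun d hd => Subgroup.mem_comap.mpr (Subgroup.mem_map.mpr ⟨d, hd, rfl⟩)

variable {q D}

/-- An element of (`H ∩`) the lifted level has the `q`-image of an element of `D ∩ K`.
[cite: Mochizuki2012, Cor 1.12 (c) p.56] -/
theorem exists_mem_inf_of_mem_liftSubgroup {H K : Subgroup P} {k : P} (hk : k ∈ H ⊓ liftSubgroup q D K) :
    ∃ d ∈ D ⊓ K, q d = q k := by
  obtain ⟨-, -, hk⟩ := hk
  exact Subgroup.mem_map.mp (Subgroup.mem_comap.mp hk)

/-- `q` is injective on `D` when `D ∩ Ker(q) = 1` ("`D_{μ_-}` is the decomposition group of a closed point":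
`D ∩ Δ = 1`). [cite: Mochizuki2012, Cor 1.12 (c) p.56] -/
theorem eq_of_q_eq (hDq : ∀ d ∈ D, q d = 1 → d = 1) {d₁ d₂ : P} (h₁ : d₁ ∈ D) (h₂ : d₂ ∈ D)
    (h : q d₁ = q d₂) : d₁ = d₂ := by
  have h' : q (d₁ * d₂⁻¹) = 1 := by rw [map_mul, map_inv, h, mul_inv_cancel]
  exact mul_inv_eq_one.mp (hDq _ (D.mul_mem h₁ (D.inv_mem h₂)) h')

variable (hDq : ∀ d ∈ D, q d = 1 → d = 1) (H : Subgroup P)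

/-- The retraction as a function: `k ↦` the (unique) `d ∈ D ∩ K` with `q(d) = q(k)` (DEFINED by choice; unique
by `eq_of_q_eq`). [cite: Mochizuki2012, Cor 1.12 (c) p.56] -/
def retractFun (K : Subgroup P) (k : ↥(H ⊓ liftSubgroup q D K)) : ↥(D ⊓ K) :=
  ⟨Classical.choose (exists_mem_inf_of_mem_liftSubgroup k.2),
    (Classical.choose_spec (exists_mem_inf_of_mem_liftSubgroup k.2)).1⟩

/-- The defining property: `q (retract k) = q k`. [cite: Mochizuki2012, Cor 1.12 (c) p.56] -/
theorem q_retractFun (K : Subgroup P) (k : ↥(H ⊓ liftSubgroup q D K)) :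
    q (retractFun H K k : P) = q k :=
  (Classical.choose_spec (exists_mem_inf_of_mem_liftSubgroup k.2)).2

include hDq in
/-- Uniqueness of the retraction: any `d ∈ D ∩ K` with `q(d) = q(k)` is `retract k`.
[cite: Mochizuki2012, Cor 1.12 (c) p.56] -/
theorem retractFun_eq (K : Subgroup P) (k : ↥(H ⊓ liftSubgroup q D K)) (d : ↥(D ⊓ K))
    (hd : q (d : P) = q k) : retractFun H K k = d :=
  Subtype.ext (eq_of_q_eq hDq (retractFun H K k).2.1 d.2.1 ((q_retractFun H K k).trans hd.symm))

include hDq in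
/-- The retraction is the identity on `D ∩ liftSubgroup K`. [cite: Mochizuki2012, Cor 1.12 (c) p.56] -/
theorem retractFun_of_mem (K : Subgroup P) (k : ↥(H ⊓ liftSubgroup q D K)) (hk : (k : P) ∈ D) :
    (retractFun H K k : P) = k :=
  congrArg Subtype.val (retractFun_eq hDq H K k ⟨k, hk, liftSubgroup_le q D K k.2.2⟩ rfl)

/-- **The retraction `H ∩ liftSubgroup K → D ∩ K`** as a group homomorphism (by uniqueness).
[cite: Mochizuki2012, Cor 1.12 (c) p.56] -/
def retract (K : Subgroup P) : ↥(H ⊓ liftSubgroup q D K) →* ↥(D ⊓ K) where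
  toFun := retractFun H K
  map_one' := retractFun_eq hDq H K 1 1 (by simp)
  map_mul' k k' := retractFun_eq hDq H K (k * k') (retractFun H K k * retractFun H K k') (by
    simp only [Subgroup.coe_mul, map_mul, q_retractFun])

/-- `retract` unfolded. [cite: Mochizuki2012, Cor 1.12 (c) p.56] -/
theorem retract_apply (K : Subgroup P) (k : ↥(H ⊓ liftSubgroup q D K)) :
    retract hDq H K k = retractFun H K k := rfl

/-- `q (retract k) = q k`. [cite: Mochizuki2012, Cor 1.12 (c) p.56] -/
theorem q_retract (K : Subgroup P) (k : ↥(H ⊓ liftSubgroup q D K)) : q (retract hDq H K k : P) = q k :=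
  q_retractFun H K k

omit [TopologicalSpace G'] [IsTopologicalGroup G'] [IsMulCommutative A] in
/-- `k` and `retract k` act identically on the coefficients, because `k · (retract k)⁻¹ ∈ Ker(q)` acts
trivially (`hN`: at the model, `Δ` acts trivially on `(l·Δ_Θ)(Π)` — `Δ_Θ` is central in `Δ^Θ`, [EtTh] §1 p. 12).
[cite: MochizukiEtTh2009, §1 p.12] -/
theorem retract_act (hN : ∀ n : P, q n = 1 → ∀ a : A, MulAut.conjNormal (φ n) a = a) (K : Subgroup P)
    (k : ↥(H ⊓ liftSubgroup q D K)) (a : A) :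
    MulAut.conjNormal (φ ((retract hDq H K k : ↥(D ⊓ K)) : P)) a = MulAut.conjNormal (φ (k : P)) a := by
  set r : P := ((retract hDq H K k : ↥(D ⊓ K)) : P) with hr
  have hn : q ((k : P) * r⁻¹) = 1 := by
    rw [map_mul, map_inv, hr, q_retract, mul_inv_cancel]
  have hk : (k : P) = (k : P) * r⁻¹ * r := by rw [inv_mul_cancel_right]
  conv_rhs => rw [hk, map_mul, map_mul, MulAut.mul_apply]
  exact (hN _ hn _).symm

/-- Compatibility of the retractions along `K₂ ≤ K₁`: the retractions of `k ∈ H ∩ liftSubgroup K₂` computed at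
`K₂` and at `K₁` coincide in `Π` (uniqueness). [cite: Mochizuki2012, Cor 1.12 (c) p.56] -/
theorem retract_compat {K₁ K₂ : Subgroup P} (h : K₂ ≤ K₁) (k : ↥(H ⊓ liftSubgroup q D K₂)) :
    ((retract hDq H K₁ (Subgroup.inclusion (inf_le_inf_left H (liftSubgroup_mono q D h)) k) : ↥(D ⊓ K₁)) : P) =
      ((retract hDq H K₂ k : ↥(D ⊓ K₂)) : P) := by
  have := retractFun_eq hDq H K₁ (Subgroup.inclusion (inf_le_inf_left H (liftSubgroup_mono q D h)) k)
    ⟨(retract hDq H K₂ k : ↥(D ⊓ K₂)), (retract hDq H K₂ k).2.1, h (retract hDq H K₂ k).2.2⟩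
    (by rw [q_retract]; rfl)
  exact congrArg Subtype.val this

variable [TopologicalSpace Q]

/-- CONTINUITY of the retraction, from `q|_{D ∩ K}` being a topological embedding (at the model: `D` is compact,
`G_k` Hausdorff) and `q` continuous: `retract = (q|_{D ∩ K})⁻¹ ∘ q`. [cite: Mochizuki2012, Cor 1.12 (c) p.56] -/
theorem continuous_retract (hq : Continuous q) (K : Subgroup P)
    (hemb : Topology.IsEmbedding fun d : ↥(D ⊓ K) => q (d : P)) : Continuous (retract hDq H K) := by
  let e := hemb.toHomeomorph
  let g : ↥(H ⊓ liftSubgroup q D K) → Set.range (fun d : ↥(D ⊓ K) => q (d : P)) :=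
    fun k => ⟨q k, retract hDq H K k, q_retract hDq H K k⟩
  have hg : Continuous g := (hq.comp continuous_subtype_val).subtype_mk _
  have h : ∀ k, retract hDq H K k = e.symm (g k) := fun k => by
    have h1 : g k = ⟨q (retract hDq H K k : P), retract hDq H K k, rfl⟩ := Subtype.ext (q_retract hDq H K k).symm
    rw [h1]
    exact (hemb.toHomeomorph_symm_apply (retract hDq H K k)).symm
  have : (retract hDq H K : _ → _) = fun k => e.symm (g k) := funext h
  rw [this]
  exact e.symm.continuous.comp hg

variable (q D) (hq : Continuous q) (hN : ∀ n : P, q n = 1 → ∀ a : A, MulAut.conjNormal (φ n) a = a)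
  (hlift : ∀ K : Subgroup P, K.FiniteIndex → IsOpen (K : Set P) →
    (liftSubgroup q D K).FiniteIndex ∧ IsOpen (liftSubgroup q D K : Set P))
  (hemb : ∀ K : Subgroup P, Topology.IsEmbedding fun d : ↥(D ⊓ K) => q (d : P))

/-- The lifted level as an index of the system over `⊥` (finite-index and open: `hlift` — at the model `q(D ∩ K)`
is an open subgroup of finite index of `G_k` and `q` is continuous). [cite: Mochizuki2012, Cor 1.12 (c) p.56] -/
def liftIdx (i : Idx (P := P) ⊥) : Idx (P := P) ⊥ :=
  OrderDual.toDual ⟨liftSubgroup q D i.K,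
    (hlift i.K (OrderDual.ofDual i).2.1 (OrderDual.ofDual i).2.2.1).1,
    (hlift i.K (OrderDual.ofDual i).2.1 (OrderDual.ofDual i).2.2.1).2, bot_le⟩

omit [TopologicalSpace Q] in
/-- The subgroup of the lifted index. [cite: Mochizuki2012, Cor 1.12 (c) p.56] -/
@[simp] theorem liftIdx_K (i : Idx (P := P) ⊥) : (liftIdx q D hlift i).K = liftSubgroup q D i.K := rfl

/-- **The canonical level retractions** for `D ≤ H ≤ Π` from an augmentation `q : Π → G_k` with `D ∩ Ker(q) = 1`,
`Ker(q)` acting trivially on the coefficients, `q` continuous, `q|_{D ∩ K}` a topological embedding, and lifted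
levels finite-index open (CONSTRUCTED: `lift K := K ∩ q⁻¹(q(D ∩ K))`, `ψ_K := (q|_{D ∩ K})⁻¹ ∘ q`).
[cite: Mochizuki2012, Cor 1.12 (c) p.56] -/
def LevelRetraction.ofAugmentation : LevelRetraction φ A H D where
  lift := liftIdx q D hlift
  le_lift i := Idx.le_iff.mpr (liftSubgroup_le q D i.K)
  lift_mono _ _ hij := Idx.le_iff.mpr (liftSubgroup_mono q D (Idx.le_iff.mp hij))
  ψ i := retract hDq H i.K
  ψ_continuous i := continuous_retract hDq H hq i.K (hemb i.K)
  ψ_act i k a := retract_act φ A hDq H hN i.K k a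
  ψ_compat _ _ hij k := retract_compat hDq H (Idx.le_iff.mp hij) k
  ψ_id i k hk := retractFun_of_mem hDq H i.K k hk

/-- The inflation section of the canonical retractions is a section of the restriction (specialisation of
`h1LimRestrict_h1LimSection`). [cite: Mochizuki2012, Cor 1.12 (ii) p.57] -/
theorem h1LimRestrict_h1LimSection_ofAugmentation (hDH : D ≤ H) (x : h1Lim φ A D ⊥) :
    h1LimRestrict φ A hDH ⊥
      ((LevelRetraction.ofAugmentation φ A q D hDq H hq hN hlift hemb).h1LimSection x) = x :=
  (LevelRetraction.ofAugmentation φ A q D hDq H hq hN hlift hemb).h1LimRestrict_h1LimSection hDH x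

end OfAugmentation

end CohomologySystemOfContH1

end

end Literature.IUT.HodgeArakelov
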